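import Literature.Analysis.FluidPDE.PassiveScalarDiagFreeDecay
import Literature.Analysis.FluidPDE.PassiveScalarDiagEnergyContinuity
import Literature.Analysis.FunctionSpaces.TorusVectorParseval
import HarnessLib

/-!
# The quiet phase: injection by a steady source during pure diagonal heat flow
# (`(S, θ(t)) ≥ -‖S‖ ‖θ₀‖ + t ‖S‖² - ½ κ t² ‖S‖²_a` for every weak solution)

Analysis/FluidPDE proof file (everything proved; no definitions). The diagonal parabolic layer
(`PassiveScalarDiag*`: weak solutions `Torus.IsWeakScalarTransportDiagForcedOn T a κ u s θ₀ θ` of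
`∂ₜθ + u·∇θ = κ ∑ᵢ aᵢ ∂ᵢ∂ᵢθ + s` on `T^d × [0,T)`, DiPerna–Lions class `L^∞_t L²_x`) has two
spellings of the symbol `Q_a(k) = ∑ᵢ aᵢ kᵢ²`: `Torus.diagFreqSq` (the mild/Duhamel files, heat rate
`Torus.diagRate κ a k = 4π²κ Q_a(k)`) and `Torus.diagSymbol` (the energy files, `A`-weighted
gradient norm `Torus.eScalarGradNormSqDiag a θ = 4π² ∑ₖ Q_a(k) |θ̂(k)|²`). Section 1 records that
they are the same function (`Torus.diagFreqSq_eq_diagSymbol`, by `rfl`) and the resulting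
dictionary `∑ₖ νₖ |θ̂(k)|² = κ ‖∇θ‖²_a` (`Torus.hasSum_diagRate_mul_sq_norm_mFourierCoeff`).

Section 3 is the one estimate of the heat phase that charge–discharge bookkeeping consumes
(a stirring field which is switched off while a steady source `S` keeps injecting): if the drift
vanishes and the source is steady on `(0,T)`, then by the drift-free Duhamel representation
(`IsWeakScalarTransportDiagForcedOn.ae_mFourierCoeff_eq_duhamel`, Pazy 1983 Ch. 4 (2.3)) every mode
of EVERY weak solution is `θ̂(t)(k) = e^{-νₖt} θ̂₀(k) + (∫₀ᵗ e^{-νₖσ} dσ) Ŝ(k)`, and Parseval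
(Grafakos 2014, Prop. 3.2.7 (3)) turns the injection rate `(S, θ(t)) = ∫ S θ(t)` into
`∑ₖ e^{-νₖt} Re(conj Ŝ(k) θ̂₀(k)) + ∑ₖ (∫₀ᵗ e^{-νₖσ} dσ) |Ŝ(k)|²`. With `e^{-νₖt} ≤ 1`,
Cauchy–Schwarz, and `t - νₖt²/2 ≤ ∫₀ᵗ e^{-νₖσ} dσ ≤ t` (from `1 - x ≤ e^{-x} ≤ 1`):

* `IsWeakScalarTransportDiagForcedOn.ae_le_integral_mul_of_steady`: for a.e. `t ∈ (0,T)`,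
  `∫ S θ(t) ≥ -√(∫S²) √(∫θ₀²) + t ∫S² - (κt²/2) ‖S‖²_a` (`‖S‖²_a = (eScalarGradNormSqDiag a S).toReal`,
  assumed finite — e.g. `S` smooth), and `…ae_integral_mul_le_of_steady`: `≤ √(∫S²) √(∫θ₀²) + t ∫S²`;
* `…le_integral_mul_of_steady_of_isL2ContinuousOn`: the lower bound at EVERY `t ∈ [0,T]` for the
  `L²`-continuous representative (both sides are continuous in `t`);
* `…le_setIntegral_integral_mul_of_steady`: the integrated form
  `∫_{(0,τ)} ∫ S θ ≥ -τ √(∫S²) √(∫θ₀²) + (τ²/2) ∫S² - (κτ³/6) ‖S‖²_a`, `0 ≤ τ ≤ T` — the energy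
  injected during a quiet window of length `τ` grows quadratically, whatever the datum.

In semigroup language these are `(S, e^{tκA}θ₀) ≥ -‖S‖‖θ₀‖` and
`(S, ∫₀ᵗ e^{σκA} S dσ) ≥ t‖S‖² - ½κt²‖S‖²_a` for the self-adjoint contraction semigroup of
`A = ∑ᵢ aᵢ∂ᵢ∂ᵢ` (`d/dσ (S, e^{σκA}S) = -κ‖e^{σκA/2}S‖²_a ≥ -κ‖S‖²_a`); the tree has no semigroup
object for this class, so everything is done on the Fourier side, for every weak solution (no
uniqueness or existence theorem is used). Only `κ ≥ 0`, `aᵢ ≥ 0` are needed.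

## Mathlib / tree search

`Torus.IsWeakScalarTransportDiagForcedOn.ae_mFourierCoeff_eq_duhamel` / `_of_steady`
(`PassiveScalarDiagFreeDecay`); `FunctionSpaces.Torus.hasSum_conj_mul_mFourierCoeff`,
`hasSum_sq_norm_mFourierCoeff_ofReal` (polarised / real Parseval); `Torus.hasSum_eScalarGradNormSqDiag`;
`IsL2ContinuousOn.continuousOn_integral_mul`; `integrableOn_integral_source_mul`. Mathlib:
`intervalIntegral.integral_comp_sub_left`, `Real.add_one_le_exp`, `Finset.sum_mul_le_sqrt_mul_sqrt`,
`Complex.hasSum_re`, `ENNReal.hasSum_toReal`, `Measure.eqOn_Icc_of_ae_eq`.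
`lean search 'diagFreqSq.*diagSymbol'`: nothing (the bridge did not exist).

## References

* A. Pazy, *Semigroups of Linear Operators and Applications to PDE*, Springer 1983, Ch. 4 §4.2,
  (2.3) (Duhamel / variation of constants). [`Pazy1983`]
* L. Grafakos, *Classical Fourier Analysis*, 3rd ed., GTM 249 (2014), Prop. 3.2.7 (3) (Parseval,
  polarised). [`Grafakos2014`]
* R. J. DiPerna, P.-L. Lions, Invent. Math. 98 (1989), §II.1 (12)–(14) (the weak class).
  [`DiPernaLions1989`]
-/

noncomputable section

open MeasureTheory Set Filter UnitAddTorus Complex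
open _root_.Topology
open scoped ENNReal NNReal ComplexConjugate

namespace Literature.Analysis.FluidPDE

namespace Torus

open Literature.Analysis.FunctionSpaces.Torus Literature.Analysis.FunctionSpaces

variable {d : Type*} [Fintype d]

/-! ## 1. One symbol, two names: `diagFreqSq = diagSymbol`, and `∑ₖ νₖ|θ̂(k)|² = κ‖∇θ‖²_a` -/

/-- **The two spellings of the diagonal symbol agree**: `Torus.diagFreqSq a k = Torus.diagSymbol a k`
(`= ∑ᵢ aᵢ kᵢ²`; definitionally). [cite: Grafakos2014, Prop. 3.1.2 (10)] -/
theorem diagFreqSq_eq_diagSymbol (a : d → ℝ) (k : d → ℤ) : diagFreqSq a k = diagSymbol a k := rfl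

/-- The two spellings agree as functions. [cite: Grafakos2014, Prop. 3.1.2 (10)] -/
theorem diagFreqSq_eq_diagSymbol' : (diagFreqSq : (d → ℝ) → (d → ℤ) → ℝ) = diagSymbol := rfl

/-- The heat rate through the energy files' symbol: `νₖ = 4π²κ Q_a(k)` with `Q_a = Torus.diagSymbol a`.
[cite: Pazy1983, Ch. 4 §4.2, (2.3) and Def. 2.3 (mild solution), p. 106] -/
theorem diagRate_eq_mul_diagSymbol (κ : ℝ) (a : d → ℝ) (k : d → ℤ) :
    diagRate κ a k = 4 * Real.pi ^ 2 * κ * diagSymbol a k := rfl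

/-- `Q_a(k) > 0` off the zero mode, for positive coefficients. [cite: Grafakos2014, Prop. 3.1.2 (10)] -/
theorem diagSymbol_pos {a : d → ℝ} (ha : ∀ i, 0 < a i) {k : d → ℤ} (hk : k ≠ 0) :
    0 < diagSymbol a k := by
  obtain ⟨i, hi⟩ : ∃ i, k i ≠ 0 := by
    by_contra hcon
    push Not at hcon
    exact hk (funext hcon)
  have hi' : (k i : ℝ) ≠ 0 := by exact_mod_cast hi
  have hle : a i * (k i : ℝ) ^ 2 ≤ diagSymbol a k :=
    Finset.single_le_sum (f := fun j => a j * (k j : ℝ) ^ 2)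
      (fun j _ => mul_nonneg (ha j).le (sq_nonneg _)) (Finset.mem_univ i)
  exact lt_of_lt_of_le (mul_pos (ha i) (by positivity)) hle

/-- `νₖ > 0` off the zero mode, for `κ > 0` and positive coefficients. [cite: Pazy1983, Ch. 4 §4.2, (2.3) and Def. 2.3 (mild solution), p. 106] -/
theorem diagRate_pos {κ : ℝ} (hκ : 0 < κ) {a : d → ℝ} (ha : ∀ i, 0 < a i) {k : d → ℤ} (hk : k ≠ 0) :
    0 < diagRate κ a k := by
  rw [diagRate_eq_mul_diagSymbol]
  have := diagSymbol_pos ha hk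
  positivity

/-- **A finite `A`-norm as a real series**: if `‖∇θ‖²_a < ∞` (and `aᵢ ≥ 0`), then
`∑ₖ 4π² Q_a(k) |θ̂(k)|² = (‖∇θ‖²_a).toReal` as a `HasSum` of real numbers. [cite: Grafakos2014, Prop. 3.2.7 (3)] -/
theorem hasSum_diagSymbol_mul_sq_norm_mFourierCoeff {a : d → ℝ} (ha : ∀ i, 0 ≤ a i)
    {θ : UnitAddTorus d → ℝ} (hθ : eScalarGradNormSqDiag a θ ≠ ⊤) :
    HasSum (fun k : d → ℤ => 4 * Real.pi ^ 2 * (diagSymbol a k * ‖mFourierCoeff (fun x => (θ x : ℂ)) k‖ ^ 2))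
      (eScalarGradNormSqDiag a θ).toReal := by
  set f : (d → ℤ) → ℝ≥0∞ := fun k =>
    ENNReal.ofReal (4 * Real.pi ^ 2 * (diagSymbol a k * ‖mFourierCoeff (fun x => (θ x : ℂ)) k‖ ^ 2)) with hf
  have hterm : ∀ k : d → ℤ, ENNReal.ofReal (4 * Real.pi ^ 2) *
      (ENNReal.ofReal (diagSymbol a k) * ‖mFourierCoeff (fun x => (θ x : ℂ)) k‖ₑ ^ 2) = f k := by
    intro k
    rw [hf]
    dsimp only
    rw [← ofReal_norm, ← ENNReal.ofReal_pow (norm_nonneg _), ← ENNReal.ofReal_mul (diagSymbol_nonneg ha k),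
      ← ENNReal.ofReal_mul (by positivity)]
  have hsum : ∑' k, f k = eScalarGradNormSqDiag a θ := by
    rw [← (hasSum_eScalarGradNormSqDiag a θ).tsum_eq]
    exact tsum_congr fun k => (hterm k).symm
  have h1 := ENNReal.hasSum_toReal (f := f) (by rwa [hsum])
  rw [← ENNReal.tsum_toReal_eq (fun k => by rw [hf]; exact ENNReal.ofReal_ne_top), hsum] at h1
  refine h1.congr_fun fun k => ?_
  rw [hf]
  dsimp only
  rw [ENNReal.toReal_ofReal]
  exact mul_nonneg (by positivity) (mul_nonneg (diagSymbol_nonneg ha k) (sq_nonneg _))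

/-- **The heat rates against the spectrum**: `∑ₖ νₖ |θ̂(k)|² = κ (‖∇θ‖²_a).toReal` whenever
`‖∇θ‖²_a < ∞` (`νₖ = Torus.diagRate κ a k`; the dictionary between the Duhamel files and the energy
files). [cite: Grafakos2014, Prop. 3.2.7 (3)] -/
theorem hasSum_diagRate_mul_sq_norm_mFourierCoeff (κ : ℝ) {a : d → ℝ} (ha : ∀ i, 0 ≤ a i)
    {θ : UnitAddTorus d → ℝ} (hθ : eScalarGradNormSqDiag a θ ≠ ⊤) :
    HasSum (fun k : d → ℤ => diagRate κ a k * ‖mFourierCoeff (fun x => (θ x : ℂ)) k‖ ^ 2)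
      (κ * (eScalarGradNormSqDiag a θ).toReal) := by
  refine ((hasSum_diagSymbol_mul_sq_norm_mFourierCoeff ha hθ).mul_left κ).congr_fun fun k => ?_
  rw [diagRate_eq_mul_diagSymbol]
  ring

/-- For smooth `S` the `A`-norm is finite, with the classical value `∑ᵢ aᵢ ∫ (∂ᵢS)²`. [cite: Grafakos2014, Prop. 3.2.7 (3)] -/
theorem eScalarGradNormSqDiag_ne_top_of_isSmooth [DecidableEq d] {a : d → ℝ} (ha : ∀ i, 0 ≤ a i)
    {S : UnitAddTorus d → ℝ} (hS : IsSmooth S) : eScalarGradNormSqDiag a S ≠ ⊤ := by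
  rw [eScalarGradNormSqDiag_eq_ofReal_sum_integral ha hS]
  exact ENNReal.ofReal_ne_top

/-- For smooth `S`: `(‖∇S‖²_a).toReal = ∑ᵢ aᵢ ∫ (∂ᵢS)²`. [cite: Grafakos2014, Prop. 3.2.7 (3)] -/
theorem toReal_eScalarGradNormSqDiag_of_isSmooth [DecidableEq d] {a : d → ℝ} (ha : ∀ i, 0 ≤ a i)
    {S : UnitAddTorus d → ℝ} (hS : IsSmooth S) :
    (eScalarGradNormSqDiag a S).toReal = ∑ i, a i * ∫ x, (FunctionSpaces.Torus.partialDeriv i S x) ^ 2 := by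
  rw [eScalarGradNormSqDiag_eq_ofReal_sum_integral ha hS, ENNReal.toReal_ofReal]
  exact Finset.sum_nonneg fun i _ => mul_nonneg (ha i) (integral_nonneg fun x => sq_nonneg _)

/-! ## 2. The Duhamel weight `∫₀ᵗ e^{-νσ} dσ` of a steady source -/

/-- `∫_{(0,t]} e^{-ν(t-τ)} dτ = ∫₀ᵗ e^{-νσ} dσ` (`σ = t - τ`). [cite: Pazy1983, Ch. 4 §4.2, (2.3) and Def. 2.3 (mild solution), p. 106] -/
theorem setIntegral_Ioc_exp_neg_mul_sub {ν t : ℝ} (ht : 0 ≤ t) :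
    ∫ τ in Ioc 0 t, Real.exp (-(ν * (t - τ))) = ∫ σ in (0:ℝ)..t, Real.exp (-(ν * σ)) := by
  have e := intervalIntegral.integral_comp_sub_left (a := 0) (b := t) (fun σ => Real.exp (-(ν * σ))) t
  simp only [sub_self, sub_zero] at e
  rw [← intervalIntegral.integral_of_le ht]
  exact e

/-- `0 ≤ ∫₀ᵗ e^{-νσ} dσ` for `t ≥ 0`. [cite: Pazy1983, Ch. 4 §4.2, (2.3) and Def. 2.3 (mild solution), p. 106] -/
theorem intervalIntegral_exp_neg_mul_nonneg (ν : ℝ) {t : ℝ} (ht : 0 ≤ t) :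
    0 ≤ ∫ σ in (0:ℝ)..t, Real.exp (-(ν * σ)) :=
  intervalIntegral.integral_nonneg ht fun _ _ => (Real.exp_pos _).le

/-- `∫₀ᵗ e^{-νσ} dσ ≤ t` for `ν ≥ 0`, `t ≥ 0` (`e^{-νσ} ≤ 1`). [cite: Pazy1983, Ch. 4 §4.2, (2.3) and Def. 2.3 (mild solution), p. 106] -/
theorem intervalIntegral_exp_neg_mul_le {ν t : ℝ} (hν : 0 ≤ ν) (ht : 0 ≤ t) :
    ∫ σ in (0:ℝ)..t, Real.exp (-(ν * σ)) ≤ t := by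
  calc ∫ σ in (0:ℝ)..t, Real.exp (-(ν * σ)) ≤ ∫ _ in (0:ℝ)..t, (1:ℝ) := by
        refine intervalIntegral.integral_mono_on ht
          ((by fun_prop : Continuous fun σ => Real.exp (-(ν * σ))).intervalIntegrable _ _)
          (continuous_const.intervalIntegrable _ _) fun σ hσ => ?_
        rw [Real.exp_le_one_iff]
        nlinarith [hσ.1]
    _ = t := by simp

/-- `t - ν t²/2 ≤ ∫₀ᵗ e^{-νσ} dσ` for `t ≥ 0` (`1 - νσ ≤ e^{-νσ}`). [cite: Pazy1983, Ch. 4 §4.2, (2.3) and Def. 2.3 (mild solution), p. 106] -/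
theorem sub_le_intervalIntegral_exp_neg_mul (ν : ℝ) {t : ℝ} (ht : 0 ≤ t) :
    t - ν * t ^ 2 / 2 ≤ ∫ σ in (0:ℝ)..t, Real.exp (-(ν * σ)) := by
  have e1 : ∫ σ in (0:ℝ)..t, (1 - ν * σ) = t - ν * t ^ 2 / 2 := by
    rw [intervalIntegral.integral_sub (continuous_const.intervalIntegrable _ _)
      ((by fun_prop : Continuous fun σ : ℝ => ν * σ).intervalIntegrable _ _),
      intervalIntegral.integral_const_mul, integral_id]
    simp
    ring
  calc t - ν * t ^ 2 / 2 = ∫ σ in (0:ℝ)..t, (1 - ν * σ) := e1.symm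
    _ ≤ ∫ σ in (0:ℝ)..t, Real.exp (-(ν * σ)) := by
        refine intervalIntegral.integral_mono_on ht
          ((by fun_prop : Continuous fun σ : ℝ => 1 - ν * σ).intervalIntegrable _ _)
          ((by fun_prop : Continuous fun σ => Real.exp (-(ν * σ))).intervalIntegrable _ _) fun σ _ => ?_
        have := Real.add_one_le_exp (-(ν * σ))
        linarith

/-! ## 3. Parseval pairing and Cauchy–Schwarz on the Fourier side -/

/-- **Polarised Parseval for two real `L²` scalars**: `∫ f g = ∑ₖ Re(conj f̂(k) ĝ(k))` as a
`HasSum` (`FunctionSpaces.Torus.hasSum_conj_mul_mFourierCoeff` for the complexified functions; the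
integral is real). [cite: Grafakos2014, Prop. 3.2.7 (3)] -/
theorem hasSum_re_conj_mFourierCoeff_mul_ofReal {f g : UnitAddTorus d → ℝ} (hf : MemLp f 2 volume)
    (hg : MemLp g 2 volume) :
    HasSum (fun k : d → ℤ =>
      (conj (mFourierCoeff (fun x => (f x : ℂ)) k) * mFourierCoeff (fun x => (g x : ℂ)) k).re)
      (∫ x, f x * g x) := by
  have h := hasSum_conj_mul_mFourierCoeff (g := fun x => (f x : ℂ)) (h := fun x => (g x : ℂ))
    hf.ofReal hg.ofReal
  have e : ∫ x, (starRingEnd ℂ) ((f x : ℝ) : ℂ) * ((g x : ℝ) : ℂ) = ((∫ x, f x * g x : ℝ) : ℂ) := by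
    rw [← integral_complex_ofReal]
    refine integral_congr_ae (ae_of_all _ fun x => ?_)
    simp only [Complex.conj_ofReal, Complex.ofReal_mul]
  rw [e] at h
  simpa only [Complex.ofReal_re] using Complex.hasSum_re h

omit [Fintype d] in
/-- **Cauchy–Schwarz for square-summable families** (`ℓ²` Hölder, `p = q = 2`): for `f, g ≥ 0` with
`∑ f²`, `∑ g²` summable, `f g` is summable and `∑ f g ≤ √(∑ f²) √(∑ g²)`. [folklore] -/
private theorem summable_mul_and_tsum_mul_le_sqrt {ι : Type*} {f g : ι → ℝ} (hf0 : ∀ i, 0 ≤ f i)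
    (hg0 : ∀ i, 0 ≤ g i) (hf : Summable fun i => f i ^ 2) (hg : Summable fun i => g i ^ 2) :
    Summable (fun i => f i * g i) ∧
      ∑' i, f i * g i ≤ Real.sqrt (∑' i, f i ^ 2) * Real.sqrt (∑' i, g i ^ 2) := by
  have hbound : ∀ s : Finset ι, ∑ i ∈ s, f i * g i ≤ Real.sqrt (∑' i, f i ^ 2) * Real.sqrt (∑' i, g i ^ 2) := by
    intro s
    have hcs := Finset.sum_mul_sq_le_sq_mul_sq s f g
    have h1 : ∑ i ∈ s, f i ^ 2 ≤ ∑' i, f i ^ 2 := hf.sum_le_tsum s fun i _ => sq_nonneg _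
    have h2 : ∑ i ∈ s, g i ^ 2 ≤ ∑' i, g i ^ 2 := hg.sum_le_tsum s fun i _ => sq_nonneg _
    have h0 : 0 ≤ ∑ i ∈ s, f i * g i := Finset.sum_nonneg fun i _ => mul_nonneg (hf0 i) (hg0 i)
    rw [← Real.sqrt_mul (tsum_nonneg fun i => sq_nonneg _)]
    calc ∑ i ∈ s, f i * g i = Real.sqrt ((∑ i ∈ s, f i * g i) ^ 2) := (Real.sqrt_sq h0).symm
      _ ≤ Real.sqrt ((∑ i ∈ s, f i ^ 2) * ∑ i ∈ s, g i ^ 2) := Real.sqrt_le_sqrt hcs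
      _ ≤ Real.sqrt ((∑' i, f i ^ 2) * ∑' i, g i ^ 2) := by gcongr
  have hsum : Summable fun i => f i * g i :=
    summable_of_sum_le (fun i => mul_nonneg (hf0 i) (hg0 i)) hbound
  exact ⟨hsum, Real.tsum_le_of_sum_le (fun i => mul_nonneg (hf0 i) (hg0 i)) hbound⟩

omit [Fintype d] in
/-- The summand bookkeeping of the Duhamel representation against the source:
`Re(conj c · (E b + W c)) = E Re(conj c · b) + W |c|²` (`E, W` real). [folklore] -/
private theorem re_conj_mul_duhamel (c b : ℂ) (E W : ℝ) :
    (conj c * ((E : ℂ) * b + (W : ℂ) * c)).re = E * (conj c * b).re + W * ‖c‖ ^ 2 := by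
  have h1 : conj c * c = ((‖c‖ ^ 2 : ℝ) : ℂ) := by
    rw [Complex.conj_mul', Complex.ofReal_pow]
  have e : conj c * ((E : ℂ) * b + (W : ℂ) * c) = (E : ℂ) * (conj c * b) + (W : ℂ) * (conj c * c) := by
    ring
  rw [e, h1, Complex.add_re, Complex.re_ofReal_mul, ← Complex.ofReal_mul, Complex.ofReal_re]

/-- `∫⁻ ‖S‖ₑ² < ∞` for `S ∈ L²`. [folklore] -/
private theorem lintegral_enorm_sq_lt_top_of_memLp_two' {S : UnitAddTorus d → ℝ} (hS : MemLp S 2 volume) :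
    ∫⁻ x, ‖S x‖ₑ ^ 2 < ⊤ := by
  have h := hS.2
  rw [eLpNorm_lt_top_iff_lintegral_rpow_enorm_lt_top two_ne_zero ENNReal.ofNat_ne_top] at h
  simpa [ENNReal.toReal_ofNat] using h

/-- A steady `L²` source is in `L¹_t L²_x` on every bounded horizon:
`∫₀ᵀ (∫ ‖s(t)‖²)^{1/2} dt < ∞` when `s(t) = S ∈ L²` on `(0,T)` (the source hypothesis of the energy
files `PassiveScalarDiagEnergy*`). [cite: DiPernaLions1989, §II.1 (12)–(14)] -/
theorem lintegral_sqrt_lintegral_sq_lt_top_of_steady {T : ℝ} {s : ℝ → UnitAddTorus d → ℝ}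
    {S : UnitAddTorus d → ℝ} (hSm : MemLp S 2 volume) (hS : ∀ t ∈ Ioo 0 T, s t = S) :
    ∫⁻ t in Ioo 0 T, (∫⁻ x, ‖s t x‖ₑ ^ 2) ^ (1 / 2 : ℝ) < ⊤ := by
  have e : ∫⁻ t in Ioo 0 T, (∫⁻ x, ‖s t x‖ₑ ^ 2) ^ (1 / 2 : ℝ) =
      ∫⁻ _ in Ioo 0 T, (∫⁻ x, ‖S x‖ₑ ^ 2) ^ (1 / 2 : ℝ) :=
    setLIntegral_congr_fun measurableSet_Ioo fun t ht => by rw [hS t ht]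
  rw [e, setLIntegral_const]
  exact ENNReal.mul_lt_top (ENNReal.rpow_lt_top_of_nonneg (by norm_num)
    (lintegral_enorm_sq_lt_top_of_memLp_two' hSm).ne) measure_Ioo_lt_top

/-! ## 4. Quiet-phase injection: every weak solution, drift-free window, steady source -/

variable [DecidableEq d]

namespace IsWeakScalarTransportDiagForcedOn

variable {T κ : ℝ} {a : d → ℝ} {u : ℝ → UnitAddTorus d → EuclideanSpace ℝ d}
  {s : ℝ → UnitAddTorus d → ℝ} {θ₀ : UnitAddTorus d → ℝ} {θ : ℝ → UnitAddTorus d → ℝ}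

/-- **All modes at once, steady source**: if the drift vanishes and `s(t) = S` on `(0,T)`
(`θ₀ ∈ L¹`), then for a.e. `t ∈ (0,T)` and EVERY `k ∈ ℤ^d`,
`θ̂(t)(k) = e^{-νₖt} θ̂₀(k) + (∫₀ᵗ e^{-νₖσ} dσ) Ŝ(k)`, `νₖ = Torus.diagRate κ a k` (one formula for all
modes, `k = 0` included: there the weight is `t`). [cite: Pazy1983, Ch. 4 §4.2, (2.3) and Def. 2.3 (mild solution), p. 106] -/
theorem ae_forall_mFourierCoeff_eq_of_steady (h : IsWeakScalarTransportDiagForcedOn T a κ u s θ₀ θ)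
    (hθ₀ : Integrable θ₀ volume) (hu0 : ∀ t ∈ Ioo 0 T, u t = 0) {S : UnitAddTorus d → ℝ}
    (hS : ∀ t ∈ Ioo 0 T, s t = S) :
    ∀ᵐ t ∂((volume : Measure ℝ).restrict (Ioo 0 T)), ∀ k : d → ℤ,
      mFourierCoeff (fun x => (θ t x : ℂ)) k =
        ((Real.exp (-(diagRate κ a k * t)) : ℝ) : ℂ) * mFourierCoeff (fun x => (θ₀ x : ℂ)) k +
        ((∫ σ in (0:ℝ)..t, Real.exp (-(diagRate κ a k * σ)) : ℝ) : ℂ) *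
          mFourierCoeff (fun x => (S x : ℂ)) k := by
  have hall := ae_all_iff.2 fun k => h.ae_mFourierCoeff_eq_duhamel hθ₀ hu0 k
  filter_upwards [hall, ae_restrict_mem measurableSet_Ioo] with t ht htI k
  rw [ht k]
  congr 1
  have e1 : ∫ τ in Ioc 0 t, ((Real.exp (-(diagRate κ a k * (t - τ))) : ℝ) : ℂ) *
        mFourierCoeff (fun x => (s τ x : ℂ)) k =
      ∫ τ in Ioc 0 t, ((Real.exp (-(diagRate κ a k * (t - τ))) : ℝ) : ℂ) *
        mFourierCoeff (fun x => (S x : ℂ)) k := by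
    refine setIntegral_congr_fun measurableSet_Ioc fun τ hτ => ?_
    rw [hS τ ⟨hτ.1, lt_of_le_of_lt hτ.2 htI.2⟩]
  rw [e1, integral_mul_const, integral_complex_ofReal, setIntegral_Ioc_exp_neg_mul_sub htI.1.le]

/-- **Quiet-phase injection, lower bound (a.e. in time).** Let `θ` be ANY weak solution of
`∂ₜθ + u·∇θ = κ ∑ᵢ aᵢ ∂ᵢ∂ᵢθ + s` on `T^d × [0,T)` with datum `θ₀ ∈ L²`, where on `(0,T)` the drift
vanishes and the source is steady, `s(t) = S ∈ L²` with `‖S‖²_a = ‖∇S‖²_a < ∞`; `κ ≥ 0`, `aᵢ ≥ 0`.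
Then for a.e. `t ∈ (0,T)`,
`∫ S θ(t) ≥ -√(∫ S²) √(∫ θ₀²) + t ∫ S² - (κ t²/2) (‖S‖²_a).toReal`
— the source keeps charging the scalar at rate `≥ ‖S‖² - κ t ‖S‖²_a` after paying once for the datum
(Duhamel mode by mode, Parseval, `e^{-νₖt} ≤ 1`, Cauchy–Schwarz, `∫₀ᵗ e^{-νₖσ} dσ ≥ t - νₖt²/2`,
`∑ₖ νₖ|Ŝ(k)|² = κ‖S‖²_a`). [cite: Pazy1983, Ch. 4 §4.2, (2.3) and Def. 2.3 (mild solution), p. 106] -/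
theorem ae_le_integral_mul_of_steady (h : IsWeakScalarTransportDiagForcedOn T a κ u s θ₀ θ)
    (hκ : 0 ≤ κ) (ha : ∀ i, 0 ≤ a i) (hθ₀ : MemLp θ₀ 2 volume) (hu0 : ∀ t ∈ Ioo 0 T, u t = 0)
    {S : UnitAddTorus d → ℝ} (hSm : MemLp S 2 volume) (hS : ∀ t ∈ Ioo 0 T, s t = S)
    (hSA : eScalarGradNormSqDiag a S ≠ ⊤) :
    ∀ᵐ t ∂((volume : Measure ℝ).restrict (Ioo 0 T)),
      -(Real.sqrt (∫ x, S x ^ 2) * Real.sqrt (∫ x, θ₀ x ^ 2)) + t * (∫ x, S x ^ 2)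
        - κ * t ^ 2 / 2 * (eScalarGradNormSqDiag a S).toReal ≤ ∫ x, S x * θ t x := by
  filter_upwards [h.ae_forall_mFourierCoeff_eq_of_steady (hθ₀.integrable one_le_two) hu0 hS,
    h.ae_memLp_two, ae_restrict_mem measurableSet_Ioo] with t hk hθt htI
  set c : (d → ℤ) → ℂ := fun k => mFourierCoeff (fun x => (S x : ℂ)) k with hc
  set b : (d → ℤ) → ℂ := fun k => mFourierCoeff (fun x => (θ₀ x : ℂ)) k with hb
  set E : (d → ℤ) → ℝ := fun k => Real.exp (-(diagRate κ a k * t)) with hE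
  set W : (d → ℤ) → ℝ := fun k => ∫ σ in (0:ℝ)..t, Real.exp (-(diagRate κ a k * σ)) with hW
  have ht0 : 0 ≤ t := htI.1.le
  have hν : ∀ k, 0 ≤ diagRate κ a k := fun k => diagRate_nonneg hκ ha k
  have hE0 : ∀ k, 0 ≤ E k := fun k => (Real.exp_pos _).le
  have hE1 : ∀ k, E k ≤ 1 := fun k => by
    rw [hE]
    dsimp only
    rw [Real.exp_le_one_iff]
    nlinarith [hν k, ht0]
  have hWlo : ∀ k, t - diagRate κ a k * t ^ 2 / 2 ≤ W k := fun k =>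
    sub_le_intervalIntegral_exp_neg_mul _ ht0
  have hWle : ∀ k, W k ≤ t := fun k => intervalIntegral_exp_neg_mul_le (hν k) ht0
  have hW0 : ∀ k, 0 ≤ W k := fun k => intervalIntegral_exp_neg_mul_nonneg _ ht0
  -- Parseval for the pairing and for the two norms
  have hpair : HasSum (fun k => (conj (c k) * mFourierCoeff (fun x => (θ t x : ℂ)) k).re)
      (∫ x, S x * θ t x) := hasSum_re_conj_mFourierCoeff_mul_ofReal hSm hθt
  have hcc : HasSum (fun k => ‖c k‖ ^ 2) (∫ x, S x ^ 2) := hasSum_sq_norm_mFourierCoeff_ofReal hSm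
  have hbb : HasSum (fun k => ‖b k‖ ^ 2) (∫ x, θ₀ x ^ 2) := hasSum_sq_norm_mFourierCoeff_ofReal hθ₀
  -- the summands, mode by mode
  have hsummand : ∀ k, (conj (c k) * mFourierCoeff (fun x => (θ t x : ℂ)) k).re =
      E k * (conj (c k) * b k).re + W k * ‖c k‖ ^ 2 := fun k => by
    rw [hk k]
    exact re_conj_mul_duhamel (c k) (b k) (E k) (W k)
  -- term 1: the datum, `≥ -‖S‖ ‖θ₀‖`
  obtain ⟨hcb, hCS⟩ := summable_mul_and_tsum_mul_le_sqrt (fun k => norm_nonneg (c k))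
    (fun k => norm_nonneg (b k)) hcc.summable hbb.summable
  rw [hcc.tsum_eq, hbb.tsum_eq] at hCS
  have hpt1 : ∀ k, |E k * (conj (c k) * b k).re| ≤ ‖c k‖ * ‖b k‖ := fun k => by
    rw [abs_mul, abs_of_nonneg (hE0 k)]
    calc E k * |(conj (c k) * b k).re| ≤ 1 * ‖conj (c k) * b k‖ :=
          mul_le_mul (hE1 k) (Complex.abs_re_le_norm _) (abs_nonneg _) zero_le_one
      _ = ‖c k‖ * ‖b k‖ := by rw [one_mul, norm_mul, Complex.norm_conj]
  have h1s : Summable fun k => E k * (conj (c k) * b k).re :=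
    Summable.of_norm_bounded hcb fun k => by rw [Real.norm_eq_abs]; exact hpt1 k
  have h1lo : -(Real.sqrt (∫ x, S x ^ 2) * Real.sqrt (∫ x, θ₀ x ^ 2)) ≤
      ∑' k, E k * (conj (c k) * b k).re := by
    have hle : ∑' k, -(‖c k‖ * ‖b k‖) ≤ ∑' k, E k * (conj (c k) * b k).re :=
      Summable.tsum_le_tsum (fun k => (abs_le.1 (hpt1 k)).1) hcb.neg h1s
    rw [tsum_neg] at hle
    linarith
  -- term 2: the source against itself, `≥ t‖S‖² - (κt²/2)‖S‖²_a`
  have hνc : HasSum (fun k => diagRate κ a k * ‖c k‖ ^ 2) (κ * (eScalarGradNormSqDiag a S).toReal) :=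
    hasSum_diagRate_mul_sq_norm_mFourierCoeff κ ha hSA
  have h2model : HasSum (fun k => (t - diagRate κ a k * t ^ 2 / 2) * ‖c k‖ ^ 2)
      (t * (∫ x, S x ^ 2) - t ^ 2 / 2 * (κ * (eScalarGradNormSqDiag a S).toReal)) := by
    have := (hcc.mul_left t).sub (hνc.mul_left (t ^ 2 / 2))
    refine this.congr_fun fun k => ?_
    ring
  have h2s : Summable fun k => W k * ‖c k‖ ^ 2 :=
    Summable.of_nonneg_of_le (fun k => mul_nonneg (hW0 k) (sq_nonneg _))
      (fun k => mul_le_mul_of_nonneg_right (hWle k) (sq_nonneg _)) (hcc.summable.mul_left t)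
  have h2lo : t * (∫ x, S x ^ 2) - t ^ 2 / 2 * (κ * (eScalarGradNormSqDiag a S).toReal) ≤
      ∑' k, W k * ‖c k‖ ^ 2 :=
    hasSum_le (fun k => mul_le_mul_of_nonneg_right (hWlo k) (sq_nonneg _)) h2model h2s.hasSum
  -- assemble
  have hpair' : HasSum (fun k => E k * (conj (c k) * b k).re + W k * ‖c k‖ ^ 2) (∫ x, S x * θ t x) := by
    refine hpair.congr_fun fun k => ?_
    exact (hsummand k).symm
  have htot : ∫ x, S x * θ t x = (∑' k, E k * (conj (c k) * b k).re) + ∑' k, W k * ‖c k‖ ^ 2 :=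
    hpair'.unique (h1s.hasSum.add h2s.hasSum)
  rw [htot]
  have e : κ * t ^ 2 / 2 * (eScalarGradNormSqDiag a S).toReal =
      t ^ 2 / 2 * (κ * (eScalarGradNormSqDiag a S).toReal) := by ring
  rw [e]
  linarith

/-- **Quiet-phase injection, upper bound (a.e. in time)**: under the same hypotheses,
`∫ S θ(t) ≤ √(∫ S²) √(∫ θ₀²) + t ∫ S²` (`∫₀ᵗ e^{-νₖσ} dσ ≤ t`; no `A`-norm needed). [cite: Pazy1983, Ch. 4 §4.2, (2.3) and Def. 2.3 (mild solution), p. 106] -/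
theorem ae_integral_mul_le_of_steady (h : IsWeakScalarTransportDiagForcedOn T a κ u s θ₀ θ)
    (hκ : 0 ≤ κ) (ha : ∀ i, 0 ≤ a i) (hθ₀ : MemLp θ₀ 2 volume) (hu0 : ∀ t ∈ Ioo 0 T, u t = 0)
    {S : UnitAddTorus d → ℝ} (hSm : MemLp S 2 volume) (hS : ∀ t ∈ Ioo 0 T, s t = S) :
    ∀ᵐ t ∂((volume : Measure ℝ).restrict (Ioo 0 T)),
      ∫ x, S x * θ t x ≤ Real.sqrt (∫ x, S x ^ 2) * Real.sqrt (∫ x, θ₀ x ^ 2) + t * (∫ x, S x ^ 2) := by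
  filter_upwards [h.ae_forall_mFourierCoeff_eq_of_steady (hθ₀.integrable one_le_two) hu0 hS,
    h.ae_memLp_two, ae_restrict_mem measurableSet_Ioo] with t hk hθt htI
  set c : (d → ℤ) → ℂ := fun k => mFourierCoeff (fun x => (S x : ℂ)) k with hc
  set b : (d → ℤ) → ℂ := fun k => mFourierCoeff (fun x => (θ₀ x : ℂ)) k with hb
  set E : (d → ℤ) → ℝ := fun k => Real.exp (-(diagRate κ a k * t)) with hE
  set W : (d → ℤ) → ℝ := fun k => ∫ σ in (0:ℝ)..t, Real.exp (-(diagRate κ a k * σ)) with hW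
  have ht0 : 0 ≤ t := htI.1.le
  have hν : ∀ k, 0 ≤ diagRate κ a k := fun k => diagRate_nonneg hκ ha k
  have hE0 : ∀ k, 0 ≤ E k := fun k => (Real.exp_pos _).le
  have hE1 : ∀ k, E k ≤ 1 := fun k => by
    rw [hE]
    dsimp only
    rw [Real.exp_le_one_iff]
    nlinarith [hν k, ht0]
  have hWle : ∀ k, W k ≤ t := fun k => intervalIntegral_exp_neg_mul_le (hν k) ht0
  have hW0 : ∀ k, 0 ≤ W k := fun k => intervalIntegral_exp_neg_mul_nonneg _ ht0
  have hpair : HasSum (fun k => (conj (c k) * mFourierCoeff (fun x => (θ t x : ℂ)) k).re)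
      (∫ x, S x * θ t x) := hasSum_re_conj_mFourierCoeff_mul_ofReal hSm hθt
  have hcc : HasSum (fun k => ‖c k‖ ^ 2) (∫ x, S x ^ 2) := hasSum_sq_norm_mFourierCoeff_ofReal hSm
  have hbb : HasSum (fun k => ‖b k‖ ^ 2) (∫ x, θ₀ x ^ 2) := hasSum_sq_norm_mFourierCoeff_ofReal hθ₀
  have hsummand : ∀ k, (conj (c k) * mFourierCoeff (fun x => (θ t x : ℂ)) k).re =
      E k * (conj (c k) * b k).re + W k * ‖c k‖ ^ 2 := fun k => by
    rw [hk k]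
    exact re_conj_mul_duhamel (c k) (b k) (E k) (W k)
  obtain ⟨hcb, hCS⟩ := summable_mul_and_tsum_mul_le_sqrt (fun k => norm_nonneg (c k))
    (fun k => norm_nonneg (b k)) hcc.summable hbb.summable
  rw [hcc.tsum_eq, hbb.tsum_eq] at hCS
  have hpt1 : ∀ k, |E k * (conj (c k) * b k).re| ≤ ‖c k‖ * ‖b k‖ := fun k => by
    rw [abs_mul, abs_of_nonneg (hE0 k)]
    calc E k * |(conj (c k) * b k).re| ≤ 1 * ‖conj (c k) * b k‖ :=
          mul_le_mul (hE1 k) (Complex.abs_re_le_norm _) (abs_nonneg _) zero_le_one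
      _ = ‖c k‖ * ‖b k‖ := by rw [one_mul, norm_mul, Complex.norm_conj]
  have h1s : Summable fun k => E k * (conj (c k) * b k).re :=
    Summable.of_norm_bounded hcb fun k => by rw [Real.norm_eq_abs]; exact hpt1 k
  have h1hi : ∑' k, E k * (conj (c k) * b k).re ≤ Real.sqrt (∫ x, S x ^ 2) * Real.sqrt (∫ x, θ₀ x ^ 2) :=
    (Summable.tsum_le_tsum (fun k => (abs_le.1 (hpt1 k)).2) h1s hcb).trans hCS
  have h2s : Summable fun k => W k * ‖c k‖ ^ 2 :=
    Summable.of_nonneg_of_le (fun k => mul_nonneg (hW0 k) (sq_nonneg _))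
      (fun k => mul_le_mul_of_nonneg_right (hWle k) (sq_nonneg _)) (hcc.summable.mul_left t)
  have h2hi : ∑' k, W k * ‖c k‖ ^ 2 ≤ t * (∫ x, S x ^ 2) :=
    hasSum_le (fun k => mul_le_mul_of_nonneg_right (hWle k) (sq_nonneg _)) h2s.hasSum (hcc.mul_left t)
  have hpair' : HasSum (fun k => E k * (conj (c k) * b k).re + W k * ‖c k‖ ^ 2) (∫ x, S x * θ t x) := by
    refine hpair.congr_fun fun k => ?_
    exact (hsummand k).symm
  have htot : ∫ x, S x * θ t x = (∑' k, E k * (conj (c k) * b k).re) + ∑' k, W k * ‖c k‖ ^ 2 :=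
    hpair'.unique (h1s.hasSum.add h2s.hasSum)
  rw [htot]
  linarith

omit [Fintype d] [DecidableEq d] in
/-- An inequality `F ≤ G` holding a.e. on `(0,T)` between functions continuous on `[0,T]` holds at
every point of `[0,T]` (`Measure.eqOn_Icc_of_ae_eq` applied to `max (F - G) 0` and `0`). [folklore] -/
private theorem le_of_ae_Ioo_le_of_continuousOn {F G : ℝ → ℝ} {T : ℝ} (hT : 0 < T)
    (hF : ContinuousOn F (Icc 0 T)) (hG : ContinuousOn G (Icc 0 T))
    (h : ∀ᵐ t ∂((volume : Measure ℝ).restrict (Ioo 0 T)), F t ≤ G t) : ∀ t ∈ Icc 0 T, F t ≤ G t := by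
  have h' : ∀ᵐ t ∂((volume : Measure ℝ).restrict (Icc 0 T)), F t ≤ G t := by
    rw [← Measure.restrict_congr_set Ioo_ae_eq_Icc]
    exact h
  have hc : ContinuousOn (fun t => max (F t - G t) 0) (Icc 0 T) :=
    (continuous_id.max continuous_const).comp_continuousOn (hF.sub hG)
  have hae : (fun t => max (F t - G t) 0) =ᵐ[volume.restrict (Icc 0 T)] fun _ => (0 : ℝ) := by
    filter_upwards [h'] with t ht
    exact max_eq_right (by linarith)
  have heq := Measure.eqOn_Icc_of_ae_eq (μ := volume) hT.ne hae hc continuousOn_const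
  intro t ht
  have h1 := heq ht
  simp only at h1
  have h2 : F t - G t ≤ max (F t - G t) 0 := le_max_left _ _
  rw [h1] at h2
  linarith

/-- **Quiet-phase injection at EVERY time, for the `L²`-continuous representative.** Under the
hypotheses of `ae_le_integral_mul_of_steady` (`T > 0`), if `θ ∈ C([0,T]; L²)`
(`Torus.IsL2ContinuousOn (Icc 0 T) θ` — every weak solution of the class has such a representative,
`exists_l2Continuous_representative`), then for EVERY `t ∈ [0,T]`
`∫ S θ(t) ≥ -√(∫ S²) √(∫ θ₀²) + t ∫ S² - (κ t²/2) (‖S‖²_a).toReal`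
(both sides are continuous in `t`: `IsL2ContinuousOn.continuousOn_integral_mul`). This is the form
read after a restart `translate_of_isL2ContinuousOn` at the beginning of a window on which the
stirring is switched off. [cite: Pazy1983, Ch. 4 §4.2, (2.3) and Def. 2.3 (mild solution), p. 106] -/
theorem le_integral_mul_of_steady_of_isL2ContinuousOn (h : IsWeakScalarTransportDiagForcedOn T a κ u s θ₀ θ)
    (hT : 0 < T) (hκ : 0 ≤ κ) (ha : ∀ i, 0 ≤ a i) (hθ₀ : MemLp θ₀ 2 volume)
    (hu0 : ∀ t ∈ Ioo 0 T, u t = 0) {S : UnitAddTorus d → ℝ} (hSm : MemLp S 2 volume)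
    (hS : ∀ t ∈ Ioo 0 T, s t = S) (hSA : eScalarGradNormSqDiag a S ≠ ⊤)
    (hc : IsL2ContinuousOn (Icc 0 T) θ) :
    ∀ t ∈ Icc 0 T,
      -(Real.sqrt (∫ x, S x ^ 2) * Real.sqrt (∫ x, θ₀ x ^ 2)) + t * (∫ x, S x ^ 2)
        - κ * t ^ 2 / 2 * (eScalarGradNormSqDiag a S).toReal ≤ ∫ x, S x * θ t x := by
  refine le_of_ae_Ioo_le_of_continuousOn hT (by fun_prop) ?_
    (h.ae_le_integral_mul_of_steady hκ ha hθ₀ hu0 hSm hS hSA)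
  refine (hc.continuousOn_integral_mul hSm).congr fun t _ => ?_
  exact integral_congr_ae (ae_of_all _ fun x => mul_comm _ _)

/-- **Upper bound at every time, for the `L²`-continuous representative**:
`∫ S θ(t) ≤ √(∫ S²) √(∫ θ₀²) + t ∫ S²` for every `t ∈ [0,T]`. [cite: Pazy1983, Ch. 4 §4.2, (2.3) and Def. 2.3 (mild solution), p. 106] -/
theorem integral_mul_le_of_steady_of_isL2ContinuousOn (h : IsWeakScalarTransportDiagForcedOn T a κ u s θ₀ θ)
    (hT : 0 < T) (hκ : 0 ≤ κ) (ha : ∀ i, 0 ≤ a i) (hθ₀ : MemLp θ₀ 2 volume)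
    (hu0 : ∀ t ∈ Ioo 0 T, u t = 0) {S : UnitAddTorus d → ℝ} (hSm : MemLp S 2 volume)
    (hS : ∀ t ∈ Ioo 0 T, s t = S) (hc : IsL2ContinuousOn (Icc 0 T) θ) :
    ∀ t ∈ Icc 0 T,
      ∫ x, S x * θ t x ≤ Real.sqrt (∫ x, S x ^ 2) * Real.sqrt (∫ x, θ₀ x ^ 2) + t * (∫ x, S x ^ 2) := by
  refine le_of_ae_Ioo_le_of_continuousOn hT ?_ (by fun_prop)
    (h.ae_integral_mul_le_of_steady hκ ha hθ₀ hu0 hSm hS)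
  refine (hc.continuousOn_integral_mul hSm).congr fun t _ => ?_
  exact integral_congr_ae (ae_of_all _ fun x => mul_comm _ _)

/-- **The pairing is integrable in time** on `(0,T)` for a steady `L²` source
(`integrableOn_integral_source_mul` with `s = S` on `(0,T)`). [cite: DiPernaLions1989, §II.1 (12)–(14)] -/
theorem integrableOn_integral_mul_of_steady (h : IsWeakScalarTransportDiagForcedOn T a κ u s θ₀ θ)
    {S : UnitAddTorus d → ℝ} (hSm : MemLp S 2 volume) (hS : ∀ t ∈ Ioo 0 T, s t = S) :
    IntegrableOn (fun t => ∫ x, S x * θ t x) (Ioo 0 T) volume := by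
  refine (h.integrableOn_integral_source_mul (lintegral_sqrt_lintegral_sq_lt_top_of_steady hSm hS)).congr_fun
    (fun t ht => ?_) measurableSet_Ioo
  simp only [hS t ht]

/-- **Quiet-phase injection, integrated over the window** `(0,τ)`, `0 ≤ τ ≤ T`: for every weak
solution as in `ae_le_integral_mul_of_steady`,
`∫_{(0,τ)} ∫ S θ ≥ -τ √(∫ S²) √(∫ θ₀²) + (τ²/2) ∫ S² - (κ τ³/6) (‖S‖²_a).toReal`
— the energy injected by the source during a stirring-free window grows quadratically in its
length, after a linear charge for the datum (integrate the a.e. bound). With the energy equality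
(`energy_eq`, `2∫∫ s θ` on the right) this is the charging step of charge–discharge bookkeeping.
[cite: Pazy1983, Ch. 4 §4.2, (2.3) and Def. 2.3 (mild solution), p. 106] -/
theorem le_setIntegral_integral_mul_of_steady (h : IsWeakScalarTransportDiagForcedOn T a κ u s θ₀ θ)
    (hκ : 0 ≤ κ) (ha : ∀ i, 0 ≤ a i) (hθ₀ : MemLp θ₀ 2 volume) (hu0 : ∀ t ∈ Ioo 0 T, u t = 0)
    {S : UnitAddTorus d → ℝ} (hSm : MemLp S 2 volume) (hS : ∀ t ∈ Ioo 0 T, s t = S)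
    (hSA : eScalarGradNormSqDiag a S ≠ ⊤) {τ : ℝ} (hτ0 : 0 ≤ τ) (hτT : τ ≤ T) :
    -(τ * (Real.sqrt (∫ x, S x ^ 2) * Real.sqrt (∫ x, θ₀ x ^ 2))) + τ ^ 2 / 2 * (∫ x, S x ^ 2)
        - κ * τ ^ 3 / 6 * (eScalarGradNormSqDiag a S).toReal ≤ ∫ t in Ioo 0 τ, ∫ x, S x * θ t x := by
  set P : ℝ := Real.sqrt (∫ x, S x ^ 2) * Real.sqrt (∫ x, θ₀ x ^ 2) with hP
  set B : ℝ := ∫ x, S x ^ 2 with hB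
  set C : ℝ := (eScalarGradNormSqDiag a S).toReal with hC
  have hint : IntegrableOn (fun t => ∫ x, S x * θ t x) (Ioo 0 τ) volume :=
    (h.integrableOn_integral_mul_of_steady hSm hS).mono_set (Ioo_subset_Ioo_right hτT)
  have hFc : Continuous fun t : ℝ => -P + t * B - κ * t ^ 2 / 2 * C := by fun_prop
  have hF : IntegrableOn (fun t : ℝ => -P + t * B - κ * t ^ 2 / 2 * C) (Ioo 0 τ) volume :=
    (hFc.integrableOn_Icc (a := 0) (b := τ)).mono_set Ioo_subset_Icc_self
  have hae : ∀ᵐ t ∂((volume : Measure ℝ).restrict (Ioo 0 τ)),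
      -P + t * B - κ * t ^ 2 / 2 * C ≤ ∫ x, S x * θ t x :=
    ae_restrict_of_ae_restrict_of_subset (Ioo_subset_Ioo_right hτT)
      (h.ae_le_integral_mul_of_steady hκ ha hθ₀ hu0 hSm hS hSA)
  have hle := setIntegral_mono_ae_restrict hF hint hae
  -- the polynomial integral
  have hderiv : ∀ x ∈ uIcc 0 τ, HasDerivAt (fun t : ℝ => -P * t + B * t ^ 2 / 2 - κ * C * t ^ 3 / 6)
      (-P + x * B - κ * x ^ 2 / 2 * C) x := by
    intro x _
    have h1 := (hasDerivAt_id x).const_mul (-P)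
    have h2 := ((hasDerivAt_pow 2 x).const_mul B).div_const 2
    have h3 := ((hasDerivAt_pow 3 x).const_mul (κ * C)).div_const 6
    have h123 := (h1.add h2).sub h3
    refine HasDerivAt.congr_deriv (h123.congr_of_eventuallyEq (Eventually.of_forall fun t => ?_)) ?_
    · simp only [id, Pi.add_apply, Pi.sub_apply]
    · push_cast
      ring
  have hpoly : ∫ t in Ioo 0 τ, (-P + t * B - κ * t ^ 2 / 2 * C) = -(τ * P) + τ ^ 2 / 2 * B - κ * τ ^ 3 / 6 * C := by
    rw [← integral_Ioc_eq_integral_Ioo, ← intervalIntegral.integral_of_le hτ0,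
      intervalIntegral.integral_eq_sub_of_hasDerivAt hderiv (hFc.intervalIntegrable _ _)]
    ring
  rw [hpoly] at hle
  exact hle

end IsWeakScalarTransportDiagForcedOn

end Torus

end Literature.Analysis.FluidPDE

end
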